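import Summits.CriticalPhenomena.SAWScalingLimit.Theorems.SAWDefectDecoherenceBoundaryClosureRPhaseFlatChart
import HarnessLib

/-!
# Crux `BoundaryClosureR` (stmt-CriticalPhenomena-14004), line `polygon-parity-squeeze`,
# stub `boundaryPhaseBookkeeping` (piece D): a conformal frame rules out slit boundary points

Let `D` be a Dobrushin domain with a conformal frame `Φ : Ω → ℍₒ` (`‖Φ‖ → ∞` at the root).  Then
no ball about a point `z`, root outside, meets `Ω` in a SLIT disc
`Ω ∩ B(z, s) = {Re((w - z) conj n) ≠ 0} ∩ B(z, s)` (`slit_false`).  Indeed the Carathéodory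
extension `Φ*` is real on the slit; reflecting `Φ* ∘ chart` from the upper half-disc and
`-conj ∘ Φ* ∘ chart ∘ conj` (again with values in `ℍₒ`) from the upper half-disc gives two
functions holomorphic on `B(0, s)` with POSITIVE real derivative at `0`
(`PhaseChart.reflect_core`), whose sum vanishes identically on the diameter — so its derivative
at `0` vanishes, a contradiction.  This is the analytic substitute for the Jordan curve theorem
in the classification of the corners of an exact polygon (a degenerate reflex presentation
`H_k ∪ H_{-k}` of `IsCornerAt` cannot occur).

References: Pommerenke, *Boundary Behaviour of Conformal Maps* (1992), Thm. 2.6.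
-/

noncomputable section

open scoped Topology ComplexConjugate
open Filter Set Metric Complex
open UpperHalfPlane (upperHalfPlaneSet)
open Literature.Probability.RandomPlanarGeometry
open Summit.CriticalPhenomena.SAWScalingLimit.Theorems.PickHalfPlane

namespace Summit.CriticalPhenomena.SAWScalingLimit.Theorems.PolygonParitySqueeze

namespace PhaseChart

/-- **A conformal frame rules out slit boundary points.** If `Φ : Ω → ℍₒ` is a conformal frame
of the Dobrushin domain `D` (`‖Φ‖ → ∞` at the root), `n` is a unit vector and the root lies
outside `B(z, s)`, then `Ω ∩ B(z, s) ≠ {Re((w - z) conj n) ≠ 0} ∩ B(z, s)`.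
[cite: PommerenkeBBCM1992, Thm. 2.6] -/
theorem slit_false (D : DobrushinDomain) (Φ : ConformalEquiv D.carrier upperHalfPlaneSet)
    (hΦ0 : Tendsto (fun z => ‖Φ z‖) (𝓝[D.carrier] (D.pt 0)) atTop)
    {z n : ℂ} (hn : ‖n‖ = 1) {s : ℝ} (hs : 0 < s)
    (hslit : D.carrier ∩ ball z s = {w : ℂ | ((w - z) * conj n).re ≠ 0} ∩ ball z s)
    (h0 : D.pt 0 ∉ ball z s) : False := by
  obtain ⟨Φs, hΦsc, hΦse, hΦsr⟩ := Identification.exists_frameExtension D Φ hΦ0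
  have hU : IsOpen D.carrier := D.isOpen
  -- unit algebra and the chart `A w = z + τ w`, `τ = -i n`
  have hnn : n * conj n = 1 := by
    rw [mul_conj, normSq_eq_norm_sq, hn]; simp
  set τ : ℂ := -I * n with hτ
  have hτ1 : ‖τ‖ = 1 := by rw [hτ, norm_mul, norm_neg, norm_I, one_mul, hn]
  set A : ℂ → ℂ := fun w => z + τ * w with hA
  have hAlev : ∀ w, ((A w - z) * conj n).re = w.im := by
    intro w
    simp only [hA]
    rw [add_sub_cancel_left, hτ, show -I * n * w * conj n = -I * w * (n * conj n) by ring, hnn,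
      mul_one]
    simp
  have hAball : ∀ {w : ℂ} {r : ℝ}, w ∈ ball (0 : ℂ) r ↔ A w ∈ ball z r := by
    intro w r
    rw [mem_ball_zero_iff, mem_ball, dist_eq_norm]
    simp only [hA]
    rw [add_sub_cancel_left, norm_mul, hτ1, one_mul]
  have hAc : Continuous A := by
    simp only [hA]
    fun_prop
  have hsymm : ∀ w ∈ ball (0 : ℂ) s, conj w ∈ ball (0 : ℂ) s := fun w hw => by
    rwa [mem_ball_zero_iff, norm_conj, ← mem_ball_zero_iff]
  -- membership
  have hcar : ∀ w ∈ ball (0 : ℂ) s, (A w ∈ D.carrier ↔ w.im ≠ 0) := by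
    intro w hw
    have h := Set.ext_iff.1 hslit (A w)
    simp only [mem_inter_iff, mem_setOf_eq, hAlev, hAball.1 hw, and_true] at h
    exact h
  have hmemU : ∀ w ∈ ball (0 : ℂ) s, w.im ≠ 0 → A w ∈ D.carrier := fun w hw h => (hcar w hw).2 h
  have haxis_cl : ∀ w ∈ ball (0 : ℂ) s, w.im = 0 → A w ∈ closure D.carrier := by
    intro w hw hwim
    have hray := Identification.tendsto_ray (A w) (τ * I)
    refine mem_closure_of_tendsto hray ?_
    have hcont : Continuous fun r : ℝ => w + (r : ℂ) * I := by fun_prop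
    have hw0 : w + ((0 : ℝ) : ℂ) * I ∈ ball (0 : ℂ) s := by simpa using hw
    have hwball : ∀ᶠ r : ℝ in 𝓝[>] 0, w + (r : ℂ) * I ∈ ball (0 : ℂ) s :=
      nhdsWithin_le_nhds ((hcont.tendsto 0) (isOpen_ball.mem_nhds hw0))
    filter_upwards [hwball, self_mem_nhdsWithin] with r hr hr0
    have hr0 : (0 : ℝ) < r := hr0
    have : A w + (r : ℂ) * (τ * I) = A (w + (r : ℂ) * I) := by
      simp only [hA]; ring
    rw [this]
    refine hmemU _ hr ?_
    simp [hwim, hr0.ne']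
  have haxis_fr : ∀ w ∈ ball (0 : ℂ) s, w.im = 0 → A w ∈ frontier D.carrier := by
    intro w hw hwim
    rw [frontier, hU.interior_eq]
    exact ⟨haxis_cl w hw hwim, fun h => (hcar w hw).1 h hwim⟩
  have hclos : ∀ w ∈ ball (0 : ℂ) s, A w ∈ closure D.carrier \ {D.pt 0} := by
    intro w hw
    refine ⟨?_, fun h => h0 (mem_singleton_iff.1 h ▸ hAball.1 hw)⟩
    by_cases hwim : w.im = 0
    · exact haxis_cl w hw hwim
    · exact subset_closure (hmemU w hw hwim)
  have hΦsd : ∀ w ∈ ball (0 : ℂ) s, w.im ≠ 0 → DifferentiableAt ℂ (fun v => Φs (A v)) w := by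
    intro w hw hwim
    have hwy : A w ∈ D.carrier := hmemU w hw hwim
    have h1 : DifferentiableAt ℂ Φs (A w) :=
      ((Φ.differentiableOn _ hwy).differentiableAt (hU.mem_nhds hwy)).congr_of_eventuallyEq
        (Filter.eventuallyEq_of_mem (hU.mem_nhds hwy) hΦse)
    have hAd : DifferentiableAt ℂ A w := by
      simp only [hA]; fun_prop
    exact h1.comp w hAd
  have hb0s : ball (0 : ℂ) s ∈ 𝓝 (0 : ℂ) := isOpen_ball.mem_nhds (mem_ball_self hs)
  -- reflection from above
  set g₁ : ℂ → ℂ := fun v => Φs (A v) with hg₁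
  have hgc₁ : ContinuousOn g₁ (ball (0 : ℂ) s ∩ {w | 0 ≤ w.im}) :=
    hΦsc.comp hAc.continuousOn fun w hw => hclos w hw.1
  have hgd₁ : DifferentiableOn ℂ g₁ (ball (0 : ℂ) s ∩ {w | 0 < w.im}) := fun w hw =>
    (hΦsd w hw.1 (ne_of_gt hw.2)).differentiableWithinAt
  have hgreal₁ : ∀ w ∈ ball (0 : ℂ) s, w.im = 0 → (g₁ w).im = 0 := fun w hw hwim =>
    hΦsr _ (haxis_fr w hw hwim)
  have hgpos₁ : ∀ w ∈ ball (0 : ℂ) s, 0 < w.im → 0 < (g₁ w).im := by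
    intro w hw hwim
    simp only [hg₁]
    rw [hΦse (hmemU w hw hwim.ne')]
    exact Φ.mapsTo (hmemU w hw hwim.ne')
  obtain ⟨hR₁, hR₁pos, -⟩ := reflect_core hs hgc₁ hgd₁ hgreal₁ hgpos₁
  -- reflection from below, after conjugation
  set g₂ : ℂ → ℂ := fun w => -((conj ∘ (fun v => Φs (A v)) ∘ conj) w) with hg₂
  have hg₂val : ∀ w, g₂ w = -conj (Φs (A (conj w))) := fun w => rfl
  have hgc₂ : ContinuousOn g₂ (ball (0 : ℂ) s ∩ {w | 0 ≤ w.im}) := by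
    have h1 : ContinuousOn (fun w => Φs (A (conj w))) (ball (0 : ℂ) s ∩ {w | 0 ≤ w.im}) :=
      hΦsc.comp (hAc.comp continuous_conj).continuousOn fun w hw => hclos _ (hsymm w hw.1)
    exact (continuous_conj.comp_continuousOn h1).neg
  have hgd₂ : DifferentiableOn ℂ g₂ (ball (0 : ℂ) s ∩ {w | 0 < w.im}) := by
    rintro w ⟨hw, hwim⟩
    have h1 : DifferentiableAt ℂ (fun v => Φs (A v)) (conj w) :=
      hΦsd _ (hsymm w hw) (by rw [conj_im]; exact neg_ne_zero.2 (ne_of_gt hwim))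
    exact (differentiableAt_conj_conj_iff.2 h1).neg.differentiableWithinAt
  have hgreal₂ : ∀ w ∈ ball (0 : ℂ) s, w.im = 0 → (g₂ w).im = 0 := by
    intro w hw hwim
    rw [hg₂val, conj_eq_iff_im.2 hwim, neg_im, conj_im, neg_neg]
    exact hΦsr _ (haxis_fr w hw hwim)
  have hgpos₂ : ∀ w ∈ ball (0 : ℂ) s, 0 < w.im → 0 < (g₂ w).im := by
    intro w hw hwim
    have hne : (conj w).im ≠ 0 := by rw [conj_im]; exact neg_ne_zero.2 hwim.ne'
    rw [hg₂val, neg_im, conj_im, neg_neg, hΦse (hmemU _ (hsymm w hw) hne)]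
    exact Φ.mapsTo (hmemU _ (hsymm w hw) hne)
  obtain ⟨hR₂, hR₂pos, -⟩ := reflect_core hs hgc₂ hgd₂ hgreal₂ hgpos₂
  -- the sum of the two reflections vanishes on the diameter
  set S : ℂ → ℂ := fun w => schwarzReflection g₁ w + schwarzReflection g₂ w with hS
  have hS0 : ∀ x : ℝ, (x : ℂ) ∈ ball (0 : ℂ) s → S x = 0 := by
    intro x hx
    have hreal : conj (Φs (A x)) = Φs (A x) :=
      conj_eq_iff_im.2 (hΦsr _ (haxis_fr x hx (ofReal_im x)))
    simp only [hS]
    rw [schwarzReflection_ofReal, schwarzReflection_ofReal, hg₂val, conj_ofReal, hreal]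
    simp [hg₁]
  have hSd : DifferentiableAt ℂ S 0 :=
    (hR₁.differentiableAt hb0s).add (hR₂.differentiableAt hb0s)
  have hderivS : deriv S 0 = deriv (schwarzReflection g₁) 0 + deriv (schwarzReflection g₂) 0 :=
    deriv_add (hR₁.differentiableAt hb0s) (hR₂.differentiableAt hb0s)
  -- the slope of `S` along the diameter vanishes, hence so does `S'(0)`
  have hslope : Tendsto (fun h : ℝ => (S (0 + (h : ℂ)) - S 0) / (h : ℂ)) (𝓝[>] 0)
      (𝓝 (deriv S 0)) := by
    have h1 : Tendsto (fun t : ℂ => t⁻¹ • (S (0 + t) - S 0)) (𝓝[≠] (0 : ℂ)) (𝓝 (deriv S 0)) :=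
      hSd.hasDerivAt.tendsto_slope_zero
    have h2 : Tendsto (fun h : ℝ => ((h : ℂ))) (𝓝[>] (0 : ℝ)) (𝓝[≠] (0 : ℂ)) :=
      tendsto_nhdsWithin_iff.2 ⟨(continuous_ofReal.tendsto' 0 0 ofReal_zero).mono_left
        nhdsWithin_le_nhds, eventually_mem_nhdsWithin.mono fun h hh => by
          simpa using (ne_of_gt (show (0 : ℝ) < h from hh))⟩
    refine (h1.comp h2).congr fun h => ?_
    simp only [Function.comp_apply, smul_eq_mul, div_eq_inv_mul]
  have hzero : ∀ᶠ h : ℝ in 𝓝[>] 0, (S (0 + (h : ℂ)) - S 0) / (h : ℂ) = 0 := by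
    have hev : ∀ᶠ h : ℝ in 𝓝[>] 0, h < s := nhdsWithin_le_nhds (Iio_mem_nhds hs)
    filter_upwards [hev, self_mem_nhdsWithin] with h hhs hh0
    have hh0 : (0 : ℝ) < h := hh0
    have hmem : ((h : ℝ) : ℂ) ∈ ball (0 : ℂ) s := by
      rw [mem_ball_zero_iff, norm_real, Real.norm_of_nonneg hh0.le]; exact hhs
    have hmem0 : ((0 : ℝ) : ℂ) ∈ ball (0 : ℂ) s := by
      rw [ofReal_zero]; exact mem_ball_self hs
    have hS00 : S 0 = 0 := by
      have := hS0 0 hmem0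
      rwa [ofReal_zero] at this
    rw [zero_add, hS0 h hmem, hS00, sub_zero, zero_div]
  have hS'0 : deriv S 0 = 0 :=
    tendsto_nhds_unique hslope (tendsto_const_nhds.congr' (hzero.mono fun h hh => hh.symm))
  have := congrArg Complex.re hS'0
  rw [hderivS, add_re, zero_re] at this
  linarith

/-! ### Registered form -/

/-- **Registered helper `phaseBookkeeping_slitFalse`** (∀-closed form of `slit_false`; sub-goal
of stub `boundaryPhaseBookkeeping`, crux stmt-CriticalPhenomena-14004, line
`polygon-parity-squeeze`): a conformal frame rules out slit boundary points.
[cite: PommerenkeBBCM1992, Thm. 2.6] -/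
theorem phaseBookkeeping_slitFalse : ∀ (D : DobrushinDomain) (Φ : ConformalEquiv D.carrier UpperHalfPlane.upperHalfPlaneSet), Filter.Tendsto (fun z => ‖Φ z‖) (𝓝[D.carrier] (D.pt 0)) Filter.atTop → ∀ (z n : ℂ) (s : ℝ), ‖n‖ = 1 → 0 < s → D.carrier ∩ Metric.ball z s = {w : ℂ | ((w - z) * (starRingEnd ℂ) n).re ≠ 0} ∩ Metric.ball z s → D.pt 0 ∉ Metric.ball z s → False :=
  fun D Φ hΦ0 _ _ _ hn hs hslit h0 => slit_false D Φ hΦ0 hn hs hslit h0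

end PhaseChart

end Summit.CriticalPhenomena.SAWScalingLimit.Theorems.PolygonParitySqueeze

end
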